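import Summits.HodgeConjecture.CorCM.Census.TwoAdicSplittingRelative

/-!
# Two-adic splitting relative to a `2`-subgroup, II: the `N`-TRACE — the principal part is free, and generation mod `2` is the
# fibre plus ONE projected condition per face orbit

COR-CM (cell `pub-hodgecm2`), count-neutral kernel combinatorics by the binder seat b09 (gen 40; lane RELATIVE SPLITTING, part III), sequel of
`Census/TwoAdicSplittingRelative.lean` (gen 40, Theorem A `hodge2_le_of_isPGroup_rel`) and `Census/CoinvariantTwoGroups.lean` (gen 29, `p`-group
Nakayama `eq_of_le_sup_aug`), with seat b23ʼs `Census/OddIndexGeneration.lean` for the integral lift; all BY NAME.  Theorems only: no definition,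
no `decide`, no certificate, no named fact, no `sorry`.
HONEST FRAMING: `HC_CM` is NOT proved, here or anywhere in the tree; nothing here is a period or a headline.

THE SETTING.  `G` finite, `c` a central involution, `G = ι(Γ)·N` with `Γ` a `2`-group (`ι : Γ → G` a homomorphism) and `N ≤ G` a NORMAL subgroup
(e.g. the normal `2`-complement of a `2`-nilpotent group: `ℤ/2^a·m`, `Q_{4n}`, `Dic(A)`, `ℤ/m ⋊ ℤ/2^k`, `P × B`).  The `N`-TRACE of a vector
`x ∈ 𝔽₂[types]` is `tr_N x = Σ_{n ∈ N} x·n⁻¹` (written out as a `Finset` sum below; for `|N|` odd it is the projection of `𝔽₂[types]` onto its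
`N`-invariants = the principal block of `𝔽₂[N]`, and `x ↦ x + tr_N x` the projection onto the non-principal blocks).  `T(S) = pair2 + 𝔽₂⟨base
changes of S⟩` is the target of a family `S`.

* §1 The trace commutes with base change (`N` normal) and absorbs base change along `N`; `T(S)` and `hodge2` are trace-stable.
* §2 **THE PRINCIPAL PART IS FREE** (`trace_hodge2_le_psp2`): for EVERY family `S ⊆ hodge2` spanning the coinvariant fibre, `tr_N(hodge2) ⊆ T(S)` —
  no coboundary hypothesis.  (Nakayama for `Γ` on `U' = tr_N(hodge2) ⊇ T' = tr_N(T(S))`: the trace of a `G`-coboundary `x·(ι(γ)n)⁻¹ − x` is the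
  `Γ`-coboundary of `tr_N x`, because the trace absorbs `n` and commutes with `ι(γ)`.)
* §3 **GENERATION = FIBRE + PROJECTED FACES** (`hodge2_le_of_fibre_of_trace`): `S` generates mod `2` iff it spans the fibre and `f + tr_N f ∈ T(S)` for
  every face `f` mod `2` (`x = tr_N x + (x + tr_N x)` in characteristic `2`); by normality it suffices to test ONE face per `G`-orbit of faces
  (`hodge2_le_of_fibre_of_trace_orbit`: any set `F` of which every face mod `2` is a base change).  The condition is necessary (`add_trace_mem_of_hodge2_le`).
  For `|N|` odd this says: the law `μ = φ₂` mod `2` holds for `S` iff the NON-PRINCIPAL projections of the faces are generated — the principal block never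
  binds (numerics `HOME/pub-hodgecm2-b09/lean-g40/RELATIVE-SPLITTING.md`: `μ₂` of the non-principal part is `φ₂ − 1` for `ℤ/10, ℤ/12, ℤ/14, ℤ/6×ℤ/2, Dic₃`
  and `4 < 8 = φ₂` for `D₁₂`).
* §4 The integral corollary `isLeast_card_gfaces_generate_of_isPGroup_trace`: `μ(G,c) = φ₂(G,c)` from a fibre-independent face family generating after
  inverting `2` whose target contains `f + tr_N f` for one face `f` per orbit, mod `2`.

## References
* [Pohlmann1968] H. Pohlmann, Algebraic cycles on abelian varieties of complex multiplication type, Ann. of Math. 88 (1968), Thm 1.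
* [Milne1999] J. S. Milne, Lefschetz motives and the Tate conjecture, Compositio Math. 117 (1999), Prop. 2.1, p. 54.
-/

namespace Summit.HodgeConjecture.CorCM.Census.Splitting

open Finset
open Summit.HodgeConjecture.CorCM.Prior.AllgGroup.RfwfAllgGroup
open Summit.HodgeConjecture.CorCM.Census.BlockParity
open Summit.HodgeConjecture.CorCM.Census.Coinvariant
open Summit.HodgeConjecture.CorCM.Census.OddIndex

noncomputable section

variable {G : Type*} [Group G] [Fintype G] [DecidableEq G] (c : G)
variable (N : Subgroup G) [DecidablePred (· ∈ N)]

/-! ## §1 The `N`-trace: commutation with base change, absorption along `N`, stability -/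

/-- **Absorption**: `tr_N (x·n₀⁻¹) = tr_N x` for `n₀ ∈ N` (reindex the sum by `n ↦ n·n₀`). [folklore] -/
theorem trace_mapDomain_rt_of_mem {n₀ : G} (hn₀ : n₀ ∈ N) (x : CMF G c →₀ ZMod 2) :
    ∑ n ∈ univ.filter (· ∈ N), Finsupp.mapDomain (rt c n) (Finsupp.mapDomain (rt c n₀) x) =
      ∑ n ∈ univ.filter (· ∈ N), Finsupp.mapDomain (rt c n) x := by
  refine Finset.sum_nbij' (fun n => n * n₀) (fun n => n * n₀⁻¹) ?_ ?_ ?_ ?_ ?_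
  · intro n hn
    exact mem_filter.mpr ⟨mem_univ _, N.mul_mem (mem_filter.mp hn).2 hn₀⟩
  · intro n hn
    exact mem_filter.mpr ⟨mem_univ _, N.mul_mem (mem_filter.mp hn).2 (N.inv_mem hn₀)⟩
  · intro n _
    rw [mul_assoc, mul_inv_cancel, mul_one]
  · intro n _
    rw [mul_assoc, inv_mul_cancel, mul_one]
  · intro n _
    rw [← mapDomain_rt_mul]

/-- **Commutation with base change** (`N` normal): `tr_N (x·g⁻¹) = (tr_N x)·g⁻¹` (reindex by conjugation). [folklore] -/
theorem trace_mapDomain_rt_comm (hNn : ∀ g : G, ∀ n ∈ N, g * n * g⁻¹ ∈ N) (g : G) (x : CMF G c →₀ ZMod 2) :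
    ∑ n ∈ univ.filter (· ∈ N), Finsupp.mapDomain (rt c n) (Finsupp.mapDomain (rt c g) x) =
      Finsupp.mapDomain (rt c g) (∑ n ∈ univ.filter (· ∈ N), Finsupp.mapDomain (rt c n) x) := by
  rw [Finsupp.mapDomain_finsetSum]
  refine Finset.sum_nbij' (fun n => g⁻¹ * n * g) (fun n => g * n * g⁻¹) ?_ ?_ ?_ ?_ ?_
  · intro n hn
    have h := hNn g⁻¹ n (mem_filter.mp hn).2
    rw [inv_inv] at h
    exact mem_filter.mpr ⟨mem_univ _, h⟩
  · intro n hn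
    exact mem_filter.mpr ⟨mem_univ _, hNn g n (mem_filter.mp hn).2⟩
  · intro n _
    group
  · intro n _
    group
  · intro n _
    rw [← mapDomain_rt_mul, ← mapDomain_rt_mul]
    congr 1
    group

/-- The trace of a member of a base-change stable submodule stays in it: `T(S)` is trace-stable. [folklore] -/
theorem trace_mem_psp2 (hcen : ∀ x : G, x * c = c * x) (S : Finset (CMF G c →₀ ZMod 2)) {t : CMF G c →₀ ZMod 2}
    (ht : t ∈ pair2 c ⊔ Submodule.span (ZMod 2) (translates2 c S)) :
    ∑ n ∈ univ.filter (· ∈ N), Finsupp.mapDomain (rt c n) t ∈ pair2 c ⊔ Submodule.span (ZMod 2) (translates2 c S) :=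
  Submodule.sum_mem _ fun n _ => mapDomain_rt_mem_psp2 c hcen S n ht

/-- `hodge2` is trace-stable (central `c`). [folklore] -/
theorem trace_mem_hodge2 (hc2 : c * c = 1) (hcen : ∀ x : G, x * c = c * x) {x : CMF G c →₀ ZMod 2} (hx : x ∈ hodge2 c hc2) :
    ∑ n ∈ univ.filter (· ∈ N), Finsupp.mapDomain (rt c n) x ∈ hodge2 c hc2 :=
  Submodule.sum_mem _ fun n _ => mapDomain_rt_mem_hodge2 c hc2 hcen n hx

/-- `pair2` is trace-stable (central `c`). [folklore] -/
theorem trace_mem_pair2 (hcen : ∀ x : G, x * c = c * x) {x : CMF G c →₀ ZMod 2} (hx : x ∈ pair2 c) :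
    ∑ n ∈ univ.filter (· ∈ N), Finsupp.mapDomain (rt c n) x ∈ pair2 c :=
  Submodule.sum_mem _ fun n _ => mapDomain_rt_mem_pair2 c hcen n hx

/-! ## §2 THE PRINCIPAL PART IS FREE: `tr_N(hodge2) ⊆ T(S)` for every fibre-spanning `S` -/

section Rel

variable {Γ : Type*} [Group Γ]

/-- **THE PRINCIPAL PART IS FREE.**  `G = ι(Γ)·N`, `Γ` a `2`-group, `N` normal; `c` central.  For EVERY family `S ⊆ hodge2` spanning the coinvariant
fibre (`hodge2 ≤ rad2 + 𝔽₂⟨S⟩`) the `N`-traces of all Hodge vectors mod `2` lie in the target: `tr_N(hodge2) ⊆ pair2 + 𝔽₂⟨base changes of S⟩`.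
No coboundary hypothesis. [folklore] -/
theorem trace_hodge2_le_psp2 (hΓ : IsPGroup 2 Γ) (ι : Γ →* G) (hNn : ∀ g : G, ∀ n ∈ N, g * n * g⁻¹ ∈ N)
    (hcov : ∀ Q : G, ∃ γ : Γ, ∃ n ∈ N, Q = ι γ * n)
    (hc2 : c * c = 1) (hcen : ∀ x : G, x * c = c * x)
    (S : Finset (CMF G c →₀ ZMod 2)) (hS : (S : Set (CMF G c →₀ ZMod 2)) ⊆ hodge2 c hc2)
    (h : hodge2 c hc2 ≤ rad2 c hc2 ⊔ Submodule.span (ZMod 2) (S : Set (CMF G c →₀ ZMod 2)))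
    {x : CMF G c →₀ ZMod 2} (hx : x ∈ hodge2 c hc2) :
    ∑ n ∈ univ.filter (· ∈ N), Finsupp.mapDomain (rt c n) x ∈ pair2 c ⊔ Submodule.span (ZMod 2) (translates2 c S) := by
  set T := pair2 c ⊔ Submodule.span (ZMod 2) (translates2 c S) with hTdef
  set trL : (CMF G c →₀ ZMod 2) →ₗ[ZMod 2] (CMF G c →₀ ZMod 2) :=
    ∑ n ∈ univ.filter (· ∈ N), Finsupp.lmapDomain (ZMod 2) (ZMod 2) (rt c n) with htrL
  have trL_apply : ∀ y : CMF G c →₀ ZMod 2, trL y = ∑ n ∈ univ.filter (· ∈ N), Finsupp.mapDomain (rt c n) y := fun y => by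
    rw [htrL, LinearMap.sum_apply]
    exact Finset.sum_congr rfl fun n _ => Finsupp.lmapDomain_apply _ _ _ _
  set ρ : Γ → (CMF G c →₀ ZMod 2) →ₗ[ZMod 2] (CMF G c →₀ ZMod 2) :=
    fun γ => Finsupp.lmapDomain (ZMod 2) (ZMod 2) (rt c (ι γ)) with hρ
  have ρ_apply : ∀ (γ : Γ) (y : CMF G c →₀ ZMod 2), ρ γ y = Finsupp.mapDomain (rt c (ι γ)) y := fun γ y => rfl
  have ρ_one : ρ 1 = LinearMap.id := by
    rw [hρ]
    show Finsupp.lmapDomain (ZMod 2) (ZMod 2) (rt c (ι 1)) = LinearMap.id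
    rw [map_one]
    exact lmapDomain_rt_one c
  have ρ_mul : ∀ γ γ' : Γ, ρ (γ * γ') = ρ γ ∘ₗ ρ γ' := fun γ γ' => by
    rw [hρ]
    show Finsupp.lmapDomain (ZMod 2) (ZMod 2) (rt c (ι (γ * γ'))) =
      Finsupp.lmapDomain (ZMod 2) (ZMod 2) (rt c (ι γ)) ∘ₗ Finsupp.lmapDomain (ZMod 2) (ZMod 2) (rt c (ι γ'))
    rw [map_mul]
    exact lmapDomain_rt_mul c _ _
  -- the trace commutes with `ρ γ` and absorbs `n ∈ N`
  have tr_ρ : ∀ (γ : Γ) (y : CMF G c →₀ ZMod 2), trL (ρ γ y) = ρ γ (trL y) := fun γ y => by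
    rw [trL_apply, trL_apply, ρ_apply, ρ_apply]
    exact trace_mapDomain_rt_comm c N hNn (ι γ) y
  have tr_n : ∀ {n : G}, n ∈ N → ∀ y : CMF G c →₀ ZMod 2, trL (Finsupp.mapDomain (rt c n) y) = trL y := fun hn y => by
    rw [trL_apply, trL_apply]
    exact trace_mapDomain_rt_of_mem c N hn y
  -- `U' = tr(hodge2)`, `T' = tr(T)`
  set U' := Submodule.map trL (hodge2 c hc2) with hU'
  set T' := Submodule.map trL T with hT'
  have hTU : T ≤ hodge2 c hc2 := psp2_le_hodge2 c hc2 hcen S hS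
  have hT'U' : T' ≤ U' := Submodule.map_mono hTU
  have hT'st : ∀ γ : Γ, ∀ t ∈ T', ρ γ t ∈ T' := by
    rintro γ _ ⟨t, ht, rfl⟩
    rw [← tr_ρ]
    exact Submodule.mem_map_of_mem (by rw [ρ_apply]; exact mapDomain_rt_mem_psp2 c hcen S (ι γ) ht)
  have hU'st : ∀ γ : Γ, ∀ u ∈ U', ρ γ u ∈ U' := by
    rintro γ _ ⟨u, hu, rfl⟩
    rw [← tr_ρ]
    exact Submodule.mem_map_of_mem (by rw [ρ_apply]; exact mapDomain_rt_mem_hodge2 c hc2 hcen (ι γ) hu)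
  -- Nakayama hypothesis: `U' ≤ T' + aug_Γ(U')`
  have haug : U' ≤ T' ⊔ Submodule.span (ZMod 2) {w | ∃ γ : Γ, ∃ u ∈ U', w = ρ γ u - u} := by
    rintro _ ⟨u, hu, rfl⟩
    have hle : rad2 c hc2 ⊔ Submodule.span (ZMod 2) (S : Set (CMF G c →₀ ZMod 2)) ≤
        Submodule.comap trL (T' ⊔ Submodule.span (ZMod 2) {w | ∃ γ : Γ, ∃ u ∈ U', w = ρ γ u - u}) := by
      refine sup_le (sup_le ?_ ?_) ?_
      · intro p hp
        exact Submodule.mem_sup_left (Submodule.mem_map_of_mem (show p ∈ T from Submodule.mem_sup_left hp))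
      · rw [aug2, Submodule.span_le]
        rintro _ ⟨Q, y, hy, rfl⟩
        obtain ⟨γ, n, hn, rfl⟩ := hcov Q
        have hyU : y ∈ hodge2 c hc2 := le_sup_left (b := pair2 c) (Submodule.subset_span hy)
        rw [SetLike.mem_coe, Submodule.mem_comap, map_sub, mapDomain_rt_mul, ← ρ_apply, tr_ρ, tr_n hn]
        exact Submodule.mem_sup_right (Submodule.subset_span ⟨γ, trL y, Submodule.mem_map_of_mem hyU, rfl⟩)
      · rw [Submodule.span_le]
        intro s hs
        exact Submodule.mem_sup_left (Submodule.mem_map_of_mem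
          (show s ∈ T from Submodule.mem_sup_right (Submodule.subset_span (subset_translates2 c S hs))))
    exact hle (h hu)
  have key := eq_of_le_sup_aug (p := 2) hΓ ρ ρ_one ρ_mul hT'U' hT'st hU'st haug
  -- conclude: `tr x ∈ U' = T' ⊆ T`
  have hxU' : trL x ∈ U' := Submodule.mem_map_of_mem hx
  rw [← key] at hxU'
  obtain ⟨t, ht, hte⟩ := hxU'
  rw [← trL_apply, ← hte, trL_apply]
  exact trace_mem_psp2 c N hcen S ht

/-! ## §3 GENERATION = FIBRE + ONE PROJECTED CONDITION PER FACE ORBIT -/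

omit [Group Γ] in
/-- `v + v = 0` in `𝔽₂[types]`. [folklore] -/
theorem add_self_finsuppTwo (v : CMF G c →₀ ZMod 2) : v + v = 0 := by
  rw [← two_nsmul, nsmul_eq_cast_smul]
  exact zero_smul (ZMod 2) v

/-- **GENERATION = FIBRE + PROJECTED FACES.**  `G = ι(Γ)·N` (`Γ` a `2`-group, `N` normal), `c` central.  If `S ⊆ hodge2` spans the coinvariant
fibre and `f + tr_N f ∈ T(S)` for every face `f` mod `2`, then `S` generates mod `2`: `hodge2 ≤ pair2 + 𝔽₂⟨base changes of S⟩`. [folklore] -/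
theorem hodge2_le_of_fibre_of_trace (hΓ : IsPGroup 2 Γ) (ι : Γ →* G) (hNn : ∀ g : G, ∀ n ∈ N, g * n * g⁻¹ ∈ N)
    (hcov : ∀ Q : G, ∃ γ : Γ, ∃ n ∈ N, Q = ι γ * n)
    (hc2 : c * c = 1) (hcen : ∀ x : G, x * c = c * x)
    (S : Finset (CMF G c →₀ ZMod 2)) (hS : (S : Set (CMF G c →₀ ZMod 2)) ⊆ hodge2 c hc2)
    (h : hodge2 c hc2 ≤ rad2 c hc2 ⊔ Submodule.span (ZMod 2) (S : Set (CMF G c →₀ ZMod 2)))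
    (hF : ∀ f ∈ faces2 c hc2,
      f + ∑ n ∈ univ.filter (· ∈ N), Finsupp.mapDomain (rt c n) f ∈ pair2 c ⊔ Submodule.span (ZMod 2) (translates2 c S)) :
    hodge2 c hc2 ≤ pair2 c ⊔ Submodule.span (ZMod 2) (translates2 c S) := by
  intro x hx
  set T := pair2 c ⊔ Submodule.span (ZMod 2) (translates2 c S) with hTdef
  set E : (CMF G c →₀ ZMod 2) →ₗ[ZMod 2] (CMF G c →₀ ZMod 2) :=
    LinearMap.id + ∑ n ∈ univ.filter (· ∈ N), Finsupp.lmapDomain (ZMod 2) (ZMod 2) (rt c n) with hE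
  have E_apply : ∀ y : CMF G c →₀ ZMod 2, E y = y + ∑ n ∈ univ.filter (· ∈ N), Finsupp.mapDomain (rt c n) y := fun y => by
    rw [hE, LinearMap.add_apply, LinearMap.id_apply, LinearMap.sum_apply]
    exact congrArg _ (Finset.sum_congr rfl fun n _ => Finsupp.lmapDomain_apply _ _ _ _)
  have hle : hodge2 c hc2 ≤ Submodule.comap E T := by
    rw [hodge2]
    refine sup_le ?_ ?_
    · rw [face2, Submodule.span_le]
      intro f hf
      rw [SetLike.mem_coe, Submodule.mem_comap, E_apply]
      exact hF f hf
    · intro p hp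
      rw [Submodule.mem_comap, E_apply]
      exact Submodule.add_mem _ (Submodule.mem_sup_left hp) (Submodule.mem_sup_left (trace_mem_pair2 c N hcen hp))
  have h1 : x + ∑ n ∈ univ.filter (· ∈ N), Finsupp.mapDomain (rt c n) x ∈ T := by
    have := hle hx
    rwa [Submodule.mem_comap, E_apply] at this
  have h2 := trace_hodge2_le_psp2 c N hΓ ι hNn hcov hc2 hcen S hS h hx
  have e : x = (x + ∑ n ∈ univ.filter (· ∈ N), Finsupp.mapDomain (rt c n) x) +
      ∑ n ∈ univ.filter (· ∈ N), Finsupp.mapDomain (rt c n) x := by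
    rw [add_assoc, add_self_finsuppTwo, add_zero]
  rw [e]
  exact Submodule.add_mem _ h1 h2

/-- NECESSITY: if `S` generates mod `2` then `x + tr_N x ∈ T(S)` for every Hodge vector `x` mod `2`. [folklore] -/
theorem add_trace_mem_of_hodge2_le (hcen : ∀ x : G, x * c = c * x) (hc2 : c * c = 1) (S : Finset (CMF G c →₀ ZMod 2))
    (hgen : hodge2 c hc2 ≤ pair2 c ⊔ Submodule.span (ZMod 2) (translates2 c S)) {x : CMF G c →₀ ZMod 2} (hx : x ∈ hodge2 c hc2) :
    x + ∑ n ∈ univ.filter (· ∈ N), Finsupp.mapDomain (rt c n) x ∈ pair2 c ⊔ Submodule.span (ZMod 2) (translates2 c S) :=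
  Submodule.add_mem _ (hgen hx) (trace_mem_psp2 c N hcen S (hgen hx))

/-- **ONE FACE PER ORBIT.**  With `N` normal the condition `f + tr_N f ∈ T(S)` is base-change invariant, so it suffices to test it on any set `F`
of which every face mod `2` is a base change (e.g. the faces at one CM type per block). [folklore] -/
theorem hodge2_le_of_fibre_of_trace_orbit (hΓ : IsPGroup 2 Γ) (ι : Γ →* G) (hNn : ∀ g : G, ∀ n ∈ N, g * n * g⁻¹ ∈ N)
    (hcov : ∀ Q : G, ∃ γ : Γ, ∃ n ∈ N, Q = ι γ * n)
    (hc2 : c * c = 1) (hcen : ∀ x : G, x * c = c * x)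
    (S : Finset (CMF G c →₀ ZMod 2)) (hS : (S : Set (CMF G c →₀ ZMod 2)) ⊆ hodge2 c hc2)
    (h : hodge2 c hc2 ≤ rad2 c hc2 ⊔ Submodule.span (ZMod 2) (S : Set (CMF G c →₀ ZMod 2)))
    (F : Set (CMF G c →₀ ZMod 2)) (hFf : ∀ f ∈ faces2 c hc2, ∃ Q : G, ∃ f₀ ∈ F, f = Finsupp.mapDomain (rt c Q) f₀)
    (hF : ∀ f ∈ F,
      f + ∑ n ∈ univ.filter (· ∈ N), Finsupp.mapDomain (rt c n) f ∈ pair2 c ⊔ Submodule.span (ZMod 2) (translates2 c S)) :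
    hodge2 c hc2 ≤ pair2 c ⊔ Submodule.span (ZMod 2) (translates2 c S) := by
  refine hodge2_le_of_fibre_of_trace c N hΓ ι hNn hcov hc2 hcen S hS h fun f hf => ?_
  obtain ⟨Q, f₀, hf₀, rfl⟩ := hFf f hf
  rw [trace_mapDomain_rt_comm c N hNn Q f₀, ← Finsupp.mapDomain_add]
  exact mapDomain_rt_mem_psp2 c hcen S Q (hF f₀ hf₀)

/-! ## §4 The integral corollary: `μ(G,c) = φ₂(G,c)` from the fibre, odd generation and one projected condition per face orbit -/

/-- **`μ(G,c) = φ₂(G,c)` by the trace test.**  `G = ι(Γ)·N` (`Γ` a `2`-group, `N` normal), `c` central `≠ 1`; `S₀` a fibre-independent face family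
generating after inverting `2`; `F` a set of vectors mod `2` of which every face mod `2` is a base change, with `f + tr_N f ∈ pair2 + 𝔽₂⟨base changes
of red S₀⟩` for every `f ∈ F`.  Then `S₀` extends to exactly `φ₂(G,c)` faces generating `hodgeSpan` modulo pairs, and no fewer faces generate. [folklore] -/
theorem isLeast_card_gfaces_generate_of_isPGroup_trace (hΓ : IsPGroup 2 Γ) (ι : Γ →* G) (hNn : ∀ g : G, ∀ n ∈ N, g * n * g⁻¹ ∈ N)
    (hcov : ∀ Q : G, ∃ γ : Γ, ∃ n ∈ N, Q = ι γ * n)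
    (hc2 : c * c = 1) (hc1 : c ≠ 1) (hcen : ∀ x : G, x * c = c * x)
    (S₀ : Finset (CMF G c →₀ ℤ)) (hS₀ : (↑S₀ : Set (CMF G c →₀ ℤ)) ⊆ gfaceSet G c hc2)
    (hli : LinearIndepOn (ZMod 2) (fun f : CMF G c →₀ ℤ => (rad2 c hc2).mkQ (red c f)) ↑S₀)
    (F : Set (CMF G c →₀ ZMod 2)) (hFf : ∀ f ∈ faces2 c hc2, ∃ Q : G, ∃ f₀ ∈ F, f = Finsupp.mapDomain (rt c Q) f₀)
    (hF : ∀ f ∈ F, f + ∑ n ∈ univ.filter (· ∈ N), Finsupp.mapDomain (rt c n) f ∈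
      pair2 c ⊔ Submodule.span (ZMod 2) (translates2 c (S₀.image (red c))))
    (k : ℕ) (htwo : ∀ y ∈ hodgeSpan c hc2,
      ((2 : ℤ) ^ k) • y ∈ Submodule.span ℤ (pairSet c) ⊔ Submodule.span ℤ (translates c S₀)) :
    IsLeast {n : ℕ | ∃ S : Finset (CMF G c →₀ ℤ), (↑S ⊆ gfaceSet G c hc2) ∧ S.card = n ∧
      hodgeSpan c hc2 ≤ Submodule.span ℤ (pairSet c) ⊔ Submodule.span ℤ (translates c S)} (fibreTwo c hc2) := by
  refine ⟨?_, ?_⟩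
  · obtain ⟨S, hS₀S, hS, hcard, hle⟩ := exists_faces_extension c hc2 S₀ hS₀ hli
    have hSH : (↑S : Set (CMF G c →₀ ℤ)) ⊆ hodgeSpan c hc2 := hS.trans (gfaceSet_subset_hodgeSpan c hc2)
    have h2 := hodge2_le_of_fibre_of_trace_orbit c N hΓ ι hNn hcov hc2 hcen (S.image (red c))
      (image_red_subset_hodge2 c hc2 S hSH) hle F hFf fun f hf => cobdry_mono c hS₀S (hF f hf)
    obtain ⟨m, hm, hodd⟩ := exists_odd_smul_mem_of_hodge2_le c hc2 hc1 hcen S hSH h2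
    have hsub : translates c S₀ ⊆ translates c S := by
      rintro _ ⟨Q, s, hs, rfl⟩
      exact ⟨Q, s, hS₀S hs, rfl⟩
    have hmono : Submodule.span ℤ (pairSet c) ⊔ Submodule.span ℤ (translates c S₀) ≤
        Submodule.span ℤ (pairSet c) ⊔ Submodule.span ℤ (translates c S) :=
      sup_le_sup_left (Submodule.span_mono hsub) _
    exact ⟨S, hS, hcard, generate_of_odd_smul_of_two_pow_smul c hc2 S hm k hodd fun y hy => hmono (htwo y hy)⟩
  · rintro n ⟨S, hS, rfl, hgen⟩
    exact fibreTwo_le_card_of_faces c hc2 hcen S hS fun y hy => hgen (gfaceSet_subset_hodgeSpan c hc2 hy)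

end Rel

end

end Summit.HodgeConjecture.CorCM.Census.Splitting
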